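import Summits.BirchSwinnertonDyer.BirchSwinnertonDyer.Theorems.Rank2ObservatoryRank3PSatCertN
import HarnessLib

/-!
# BirchSwinnertonDyer — rank ≥ 2 observatory: rank-3 `p`-saturation certificates, computed witnesses

HONEST FRAMING: per-curve certified theorems and census instruments; no claim on BSD in rank ≥ 2.

The DENSE form of the odd-`p` saturation row certificate (lane `u = 0`). The witness chains are no
longer DATA: for each normalised residue triple `(a, b, c)` and each certified witness prime
`(q, N) ∈ Q` the kernel COMPUTES `k = N / p`, a joint double-and-add operation list for
`(k a, k b, k c)` (`jointOps`), and the chain's points by the affine formulas modulo `q`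
(`zmodAddC`, `zmodDblC`, inverse by Fermat `invMod`), producing a candidate TRACE (`traceC`) which
is then VALIDATED by the landed checker `chain3B` and the coefficient bookkeeping `chain3Coeffs` —
so soundness needs nothing about the computing functions (any trace passing `chain3B` with the right
coefficients is a witness, `not_mem_pCoset_zero_of_chain3`). The row datum `Rank3PSatCertC` is only:
scale, scaled integral generators, kernel counts `S` + annihilator `t`, and the witness primes with
counts `Q` (≈ 2 lines per row instead of ≈ 25).

* `invMod`, `zmodAddC`, `zmodDblC`, `stepC`, `traceC`, `bitLen`, `addOps`, `lowerOps`, `jointOps` —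
  computing functions (no lemmas needed);
* `pWitnessC` + `not_mem_pCoset_of_pWitnessC` — one class at one prime;
* `pSaturated_of_certPC` — normalised classes, each served by SOME prime of `Q` (`List.any`);
* `Rank3PSatCertC`, `rank3PSatCheckC`, `Rank3Row.pSaturated_of_pSatCheckC[All]`.

Sorry-free; no `decide` executed in this file.

References: S. Siksek, Rocky Mountain J. Math. 25 (1995) §3; J. E. Cremona, *Algorithms for
Modular Elliptic Curves* (1997) §3.5; J. H. Silverman, AEC (2009) III.2.3.
-/

-- single-conjunct summit: `Summit.BirchSwinnertonDyer.BirchSwinnertonDyer.…` repeats the name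
set_option linter.dupNamespace false

namespace Summit.BirchSwinnertonDyer.BirchSwinnertonDyer.Rank2Observatory

open WeierstrassCurve

/-! ### Computing functions (unverified; their output is re-validated) -/

/-- Fast modular power with fuel (structural recursion): `acc · b^e mod q`. [folklore] -/
def powModAux (q : ℕ) : ℕ → ℕ → ℕ → ℕ → ℕ
  | 0, _, _, acc => acc
  | fuel + 1, b, e, acc =>
    if e = 0 then acc
    else powModAux q fuel (b * b % q) (e / 2) (if e % 2 = 1 then acc * b % q else acc)

/-- `a^(q−2) mod q` — the inverse of `a` modulo a prime `q` (Fermat). [folklore] -/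
def invMod (q a : ℕ) : ℕ := powModAux q 64 (a % q) (q - 2) 1

/-- Computed chord `(x₁, y₁) + (x₂, y₂)` modulo `q` (`none` if `x₁ = x₂`).
[cite: SilvermanAEC2009, III.2.3] -/
def zmodAddC (V : WeierstrassCurve ℤ) (q : ℕ) [NeZero q] (x₁ y₁ x₂ y₂ : ZMod q) :
    Option (ZMod q × ZMod q) :=
  if x₁ = x₂ then none
  else
    let l := (y₁ - y₂) * ((invMod q (x₁ - x₂).val : ℕ) : ZMod q)
    let x₃ := l ^ 2 + (V.a₁ : ZMod q) * l - (V.a₂ : ZMod q) - x₁ - x₂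
    some (x₃, -(l * (x₃ - x₁) + y₁) - (V.a₁ : ZMod q) * x₃ - (V.a₃ : ZMod q))

/-- Computed tangent `2 · (x₁, y₁)` modulo `q` (`none` on a vertical tangent).
[cite: SilvermanAEC2009, III.2.3] -/
def zmodDblC (V : WeierstrassCurve ℤ) (q : ℕ) [NeZero q] (x₁ y₁ : ZMod q) :
    Option (ZMod q × ZMod q) :=
  let D := 2 * y₁ + (V.a₁ : ZMod q) * x₁ + (V.a₃ : ZMod q)
  if D = 0 then none
  else
    let l := (3 * x₁ ^ 2 + 2 * (V.a₂ : ZMod q) * x₁ + (V.a₄ : ZMod q) - (V.a₁ : ZMod q) * y₁) *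
      ((invMod q D.val : ℕ) : ZMod q)
    let x₃ := l ^ 2 + (V.a₁ : ZMod q) * l - (V.a₂ : ZMod q) - 2 * x₁
    some (x₃, -(l * (x₃ - x₁) + y₁) - (V.a₁ : ZMod q) * x₃ - (V.a₃ : ZMod q))

/-- One computed chain step. [folklore] -/
def stepC (V : WeierstrassCurve ℤ) (q : ℕ) [NeZero q] (g₁ g₂ g₃ cur : ZMod q × ZMod q) :
    Op → Option (ZMod q × ZMod q)
  | .dbl => zmodDblC V q cur.1 cur.2
  | .add₁ => zmodAddC V q cur.1 cur.2 g₁.1 g₁.2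
  | .add₂ => zmodAddC V q cur.1 cur.2 g₂.1 g₂.2
  | .add₃ => zmodAddC V q cur.1 cur.2 g₃.1 g₃.2

/-- The computed TRACE of an operation list from `cur`: the operations with their points, in the
format of `chain3B`. [folklore] -/
def traceC (V : WeierstrassCurve ℤ) (q : ℕ) [NeZero q] (g₁ g₂ g₃ : ZMod q × ZMod q) :
    ZMod q × ZMod q → List Op → Option (List (Op × ZMod q × ZMod q))
  | _, [] => some []
  | cur, op :: rest =>
    match stepC V q g₁ g₂ g₃ cur op with
    | none => none
    | some P =>
      match traceC V q g₁ g₂ g₃ P rest with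
      | none => none
      | some tr => some ((op, P) :: tr)

/-- Bit length with fuel. [folklore] -/
def bitLenAux : ℕ → ℕ → ℕ
  | 0, _ => 0
  | fuel + 1, n => if n = 0 then 0 else bitLenAux fuel (n / 2) + 1

/-- Bit length (`n < 2^64`). [folklore] -/
def bitLen (n : ℕ) : ℕ := bitLenAux 64 n

/-- The additions for bit `j`. [folklore] -/
def addOps (n₁ n₂ n₃ j : ℕ) : List Op :=
  (if n₁ / 2 ^ j % 2 = 1 then [Op.add₁] else []) ++
    (if n₂ / 2 ^ j % 2 = 1 then [Op.add₂] else []) ++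
    (if n₃ / 2 ^ j % 2 = 1 then [Op.add₃] else [])

/-- Double-and-add operations for the bits below `j`. [folklore] -/
def lowerOps (n₁ n₂ n₃ : ℕ) : ℕ → List Op
  | 0 => []
  | j + 1 => Op.dbl :: addOps n₁ n₂ n₃ j ++ lowerOps n₁ n₂ n₃ j

/-- JOINT double-and-add plan for `n₁P₁ + n₂P₂ + n₃P₃`: the start generator and the operation list
(left-to-right from the top bit). [folklore] -/
def jointOps (n₁ n₂ n₃ : ℕ) : Op × List Op :=
  let L := max (bitLen n₁) (max (bitLen n₂) (bitLen n₃)) - 1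
  match addOps n₁ n₂ n₃ L with
  | [] => (.add₁, [])
  | s :: rest => (s, rest ++ lowerOps n₁ n₂ n₃ L)

/-! ### One class at one prime -/

/-- COMPUTED WITNESS CHECK for the class `(a, b, c)` at the certified count `(q, N)`: `N = p·k`,
the computed trace of the joint plan for `(ka, kb, kc)` passes `chain3B` and reaches those
coefficients. [cite: CremonaAlgorithms1997, §3.5] -/
def pWitnessC (V : WeierstrassCurve ℤ) (p : ℕ) (X₁ Y₁ X₂ Y₂ X₃ Y₃ : ℤ) (abc : ℤ × ℤ × ℤ) :
    ℕ × ℕ → Bool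
  | (0, _) => false
  | (q + 1, N) =>
    let g₁ : ZMod (q + 1) × ZMod (q + 1) := ((X₁ : ZMod (q + 1)), (Y₁ : ZMod (q + 1)))
    let g₂ : ZMod (q + 1) × ZMod (q + 1) := ((X₂ : ZMod (q + 1)), (Y₂ : ZMod (q + 1)))
    let g₃ : ZMod (q + 1) × ZMod (q + 1) := ((X₃ : ZMod (q + 1)), (Y₃ : ZMod (q + 1)))
    let k := N / p
    let so := jointOps (k * abc.1.toNat) (k * abc.2.1.toNat) (k * abc.2.2.toNat)
    decide (N = p * k) &&
      match traceC V (q + 1) g₁ g₂ g₃ (startPt g₁ g₂ g₃ so.1) so.2 with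
      | none => false
      | some tr =>
        chain3B V (q + 1) g₁ g₂ g₃ (startPt g₁ g₂ g₃ so.1) tr &&
          decide (chain3Coeffs (startCoeffs so.1) tr =
            ((k : ℤ) * abc.1, (k : ℤ) * abc.2.1, (k : ℤ) * abc.2.2))

open scoped Classical in
/-- **Soundness of the computed witness**: `aP₁ + bP₂ + cP₃ ∉ p•E'(ℚ)` for the integral points
`Pᵢ = (Xᵢ, Yᵢ)` of `E' = V` (the validated trace is a `chain3B` chain;
`not_mem_pCoset_zero_of_chain3`). [cite: SilvermanAEC2009, VII.3] -/
theorem not_mem_pCoset_of_pWitnessC (V : WeierstrassCurve ℤ) (hΔ : V.Δ ≠ 0) {p q N : ℕ}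
    (hqN : killerB V (q, N) = true) {X₁ Y₁ X₂ Y₂ X₃ Y₃ : ℤ}
    (e₁ : Y₁ ^ 2 + V.a₁ * X₁ * Y₁ + V.a₃ * Y₁ = X₁ ^ 3 + V.a₂ * X₁ ^ 2 + V.a₄ * X₁ + V.a₆)
    (e₂ : Y₂ ^ 2 + V.a₁ * X₂ * Y₂ + V.a₃ * Y₂ = X₂ ^ 3 + V.a₂ * X₂ ^ 2 + V.a₄ * X₂ + V.a₆)
    (e₃ : Y₃ ^ 2 + V.a₁ * X₃ * Y₃ + V.a₃ * Y₃ = X₃ ^ 3 + V.a₂ * X₃ ^ 2 + V.a₄ * X₃ + V.a₆)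
    {a b c : ℤ} (hw : pWitnessC V p X₁ Y₁ X₂ Y₂ X₃ Y₃ (a, b, c) (q, N) = true) :
    a • (Affine.Point.some (X₁ : ℚ) (Y₁ : ℚ) (nonsingular_rat_of_eq V hΔ e₁) :
        (V.map (Int.castRingHom ℚ)).toAffine.Point)
      + b • Affine.Point.some (X₂ : ℚ) (Y₂ : ℚ) (nonsingular_rat_of_eq V hΔ e₂)
      + c • Affine.Point.some (X₃ : ℚ) (Y₃ : ℚ) (nonsingular_rat_of_eq V hΔ e₃) ∉
      pCoset (V.map (Int.castRingHom ℚ)).toAffine.Point p 0 := by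
  cases q with
  | zero => simp [pWitnessC] at hw
  | succ q =>
    obtain ⟨hprime, hq, hcount⟩ := killerB_sound V hqN
    haveI : Fact (q + 1).Prime := ⟨hprime⟩
    simp only [pWitnessC, Bool.and_eq_true, decide_eq_true_eq] at hw
    obtain ⟨hNk, hrest⟩ := hw
    split at hrest
    · exact absurd hrest Bool.false_ne_true
    · rename_i tr htr
      simp only [Bool.and_eq_true, decide_eq_true_eq] at hrest
      obtain ⟨hchain, hcoef⟩ := hrest
      have E₁ : V.toAffine.Equation X₁ Y₁ := (Affine.equation_iff X₁ Y₁).mpr e₁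
      have E₂ : V.toAffine.Equation X₂ Y₂ := (Affine.equation_iff X₂ Y₂).mpr e₂
      have E₃ : V.toAffine.Equation X₃ Y₃ := (Affine.equation_iff X₃ Y₃).mpr e₃
      exact not_mem_pCoset_zero_of_chain3 V (q + 1) hq (p := p) (k := N / p)
        (by rw [hcount]; exact hNk) _ _ _ (reduceMod_some V (q + 1) hq E₁ _)
        (reduceMod_some V (q + 1) hq E₂ _) (reduceMod_some V (q + 1) hq E₃ _) _ hchain hcoef

/-! ### The certificate on the scaled model, computed witnesses -/

open scoped Classical in
/-- **`p`-saturation on the integral model from COMPUTED witnesses**: every normalised class is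
served by some certified prime of `Q` (as `pSaturated_of_certPN`).
[cite: CremonaAlgorithms1997, §3.5] -/
theorem pSaturated_of_certPC (V : WeierstrassCurve ℤ) (hΔ : V.Δ ≠ 0) {X₁ Y₁ X₂ Y₂ X₃ Y₃ : ℤ}
    (e₁ : Y₁ ^ 2 + V.a₁ * X₁ * Y₁ + V.a₃ * Y₁ = X₁ ^ 3 + V.a₂ * X₁ ^ 2 + V.a₄ * X₁ + V.a₆)
    (e₂ : Y₂ ^ 2 + V.a₁ * X₂ * Y₂ + V.a₃ * Y₂ = X₂ ^ 3 + V.a₂ * X₂ ^ 2 + V.a₄ * X₂ + V.a₆)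
    (e₃ : Y₃ ^ 2 + V.a₁ * X₃ * Y₃ + V.a₃ * Y₃ = X₃ ^ 3 + V.a₂ * X₃ ^ 2 + V.a₄ * X₃ + V.a₆)
    {p : ℕ} (hp : p.Prime) {S : List (ℕ × ℕ)} {t : ℕ}
    (hS : ∀ ℓN ∈ S, ℓN.1.Prime ∧
      ∀ (x : (V.map (Int.castRingHom ℚ)).toAffine.Point) (n : ℕ), ¬ ℓN.1 ∣ n → n • x = 0 →
        ℓN.2 • x = 0)
    (ht : annihilatorCheck S t = true) (hpt : ¬ (p : ℤ) ∣ (t : ℤ)) {Q : List (ℕ × ℕ)}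
    (hQ : Q.all (killerB V) = true)
    (hall : (normTriples p).all (fun abc => Q.any (pWitnessC V p X₁ Y₁ X₂ Y₂ X₃ Y₃ abc))
      = true) :
    ∀ x : (V.map (Int.castRingHom ℚ)).toAffine.Point,
      p • x ∈ AddSubgroup.closure
          {Affine.Point.some (X₁ : ℚ) (Y₁ : ℚ) (nonsingular_rat_of_eq V hΔ e₁),
            Affine.Point.some (X₂ : ℚ) (Y₂ : ℚ) (nonsingular_rat_of_eq V hΔ e₂),
            Affine.Point.some (X₃ : ℚ) (Y₃ : ℚ) (nonsingular_rat_of_eq V hΔ e₃)} ⊔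
          AddCommGroup.torsion _ →
      x ∈ AddSubgroup.closure
          {Affine.Point.some (X₁ : ℚ) (Y₁ : ℚ) (nonsingular_rat_of_eq V hΔ e₁),
            Affine.Point.some (X₂ : ℚ) (Y₂ : ℚ) (nonsingular_rat_of_eq V hΔ e₂),
            Affine.Point.some (X₃ : ℚ) (Y₃ : ℚ) (nonsingular_rat_of_eq V hΔ e₃)} ⊔
          AddCommGroup.torsion _ := by
  -- a listed class has a certified prime at which the computed witness checks
  have W : ∀ {abc : ℤ × ℤ × ℤ}, abc ∈ normTriples p →
      ∃ q N, killerB V (q, N) = true ∧ pWitnessC V p X₁ Y₁ X₂ Y₂ X₃ Y₃ abc (q, N) = true := by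
    intro abc h
    have h1 := List.all_eq_true.mp hall _ h
    obtain ⟨⟨q, N⟩, hmem, hw⟩ := List.any_eq_true.mp h1
    exact ⟨q, N, List.all_eq_true.mp hQ _ hmem, hw⟩
  refine listedSpan_saturated_of_not_mem_pCoset hp (u := 0) (m := (t : ℤ))
    (isCoprime_of_prime_of_not_dvd hp hpt) ?_ (residues_of_normalised hp ?_ ?_ ?_)
  · intro x hx
    rw [pow_zero, one_mul, natCast_zsmul]
    exact nsmul_eq_zero_of_annihilatorCheck hS ht hx
  · intro b c hb hb' hc hc'
    obtain ⟨q, N, hqN, hw⟩ := W (mem_normTriples₁ hb hb' hc hc')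
    have key := not_mem_pCoset_of_pWitnessC V hΔ hqN e₁ e₂ e₃ hw
    simpa only [one_smul, one_zsmul] using key
  · intro c hc hc'
    obtain ⟨q, N, hqN, hw⟩ := W (mem_normTriples₂ hc hc')
    have key := not_mem_pCoset_of_pWitnessC V hΔ hqN e₁ e₂ e₃ hw
    simpa only [zero_smul, zero_zsmul, zero_add, one_smul, one_zsmul] using key
  · obtain ⟨q, N, hqN, hw⟩ := W (mem_normTriples₃ p)
    have key := not_mem_pCoset_of_pWitnessC V hΔ hqN e₁ e₂ e₃ hw
    simpa only [zero_smul, zero_zsmul, zero_add, one_smul, one_zsmul] using key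

/-! ### The row certificate, computed witnesses -/

/-- The DENSE `p`-SATURATION CERTIFICATE of a rank-3 row: scale `d`, the integral points
`(Xᵢ, Yᵢ)` on `scaleModel _ d`, kernel counts `S`, torsion annihilator `t`, witness primes with
counts `Q`. [cite: CremonaAlgorithms1997, §3.5] -/
structure Rank3PSatCertC where
  /-- scale of the integral model -/
  d : ℤ
  /-- `x`-coordinate of the first scaled generator -/
  X₁ : ℤ
  /-- `y`-coordinate of the first scaled generator -/
  Y₁ : ℤ
  /-- `x`-coordinate of the second scaled generator -/
  X₂ : ℤ
  /-- `y`-coordinate of the second scaled generator -/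
  Y₂ : ℤ
  /-- `x`-coordinate of the third scaled generator -/
  X₃ : ℤ
  /-- `y`-coordinate of the third scaled generator -/
  Y₃ : ℤ
  /-- kernel point counts `(ℓ, #Ẽ(𝔽_ℓ))` for the annihilator -/
  S : List (ℕ × ℕ)
  /-- torsion annihilator -/
  t : ℕ
  /-- witness primes with counts `(q, #Ẽ(𝔽_q))` -/
  Q : List (ℕ × ℕ)

/-- **The dense row Boolean** (kernel `decide`): base checks as `rank3PSatCheck`, then every
normalised class is served by some prime of `Q` with a COMPUTED, validated chain.
[cite: CremonaAlgorithms1997, §3.5] -/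
def rank3PSatCheckC (r : Rank3Row) (p : ℕ) (c : Rank3PSatCertC) : Bool :=
  let V := scaleModel r.intModel c.d
  decide (c.d ≠ 0 ∧ V.Δ ≠ 0 ∧ p.Prime ∧ ¬ (p : ℤ) ∣ (c.t : ℤ) ∧
      c.X₁ * r.P₁.2.2 = c.d ^ 2 * r.P₁.1 ∧ c.Y₁ * r.P₁.2.2 = c.d ^ 3 * r.P₁.2.1 ∧
      c.X₂ * r.P₂.2.2 = c.d ^ 2 * r.P₂.1 ∧ c.Y₂ * r.P₂.2.2 = c.d ^ 3 * r.P₂.2.1 ∧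
      c.X₃ * r.P₃.2.2 = c.d ^ 2 * r.P₃.1 ∧ c.Y₃ * r.P₃.2.2 = c.d ^ 3 * r.P₃.2.1 ∧
      c.Y₁ ^ 2 + V.a₁ * c.X₁ * c.Y₁ + V.a₃ * c.Y₁ =
        c.X₁ ^ 3 + V.a₂ * c.X₁ ^ 2 + V.a₄ * c.X₁ + V.a₆ ∧
      c.Y₂ ^ 2 + V.a₁ * c.X₂ * c.Y₂ + V.a₃ * c.Y₂ =
        c.X₂ ^ 3 + V.a₂ * c.X₂ ^ 2 + V.a₄ * c.X₂ + V.a₆ ∧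
      c.Y₃ ^ 2 + V.a₁ * c.X₃ * c.Y₃ + V.a₃ * c.Y₃ =
        c.X₃ ^ 3 + V.a₂ * c.X₃ ^ 2 + V.a₄ * c.X₃ + V.a₆) &&
  annihilatorCheck c.S c.t && c.S.all (killerB V) && c.Q.all (killerB V) &&
  (normTriples p).all fun abc => c.Q.any (pWitnessC V p c.X₁ c.Y₁ c.X₂ c.Y₂ c.X₃ c.Y₃ abc)

/-- **SOUNDNESS of the dense row certificate**: the listed span `ℤP₁ + ℤP₂ + ℤP₃ + E(ℚ)_tors`
is `p`-SATURATED in `E(ℚ) = r.curve⟮ℚ⟯`. [cite: CremonaAlgorithms1997, §3.5]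
[cite: SilvermanAEC2009, III.3.1(b)] -/
theorem Rank3Row.pSaturated_of_pSatCheckC (r : Rank3Row) (h : r.check = true) (p : ℕ)
    (c : Rank3PSatCertC) (hc : rank3PSatCheckC r p c = true) :
    ∀ a : r.curve.toAffine.Point,
      p • a ∈ AddSubgroup.closure {r.gen₁ h, r.gen₂ h, r.gen₃ h} ⊔ AddCommGroup.torsion _ →
        a ∈ AddSubgroup.closure {r.gen₁ h, r.gen₂ h, r.gen₃ h} ⊔ AddCommGroup.torsion _ := by
  simp only [rank3PSatCheckC, Bool.and_eq_true, decide_eq_true_eq] at hc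
  obtain ⟨⟨⟨⟨⟨hd, hΔ, hp, hpt, hX₁, hY₁, hX₂, hY₂, hX₃, hY₃, e₁, e₂, e₃⟩, hann⟩, hS⟩, hQ⟩,
    hall⟩ := hc
  exact r.pSaturated_of_scaled h hd hX₁ hY₁ hX₂ hY₂ hX₃ hY₃ hΔ e₁ e₂ e₃ p
    (pSaturated_of_certPC _ hΔ e₁ e₂ e₃ hp (killers_of_all_killerB _ hS) hann hpt hQ hall)

/-- The dense Boolean over a list of rows and certificates (same order). [folklore] -/
def rank3PSatCheckCAll (p : ℕ) : List Rank3Row → List Rank3PSatCertC → Bool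
  | [], _ => true
  | _ :: _, [] => false
  | r :: rs, c :: cs => rank3PSatCheckC r p c && rank3PSatCheckCAll p rs cs

/-- **Soundness of the list form, dense certificates.** [cite: CremonaAlgorithms1997, §3.5] -/
theorem Rank3Row.pSaturated_of_pSatCheckCAll (p : ℕ) :
    ∀ {rows : List Rank3Row} {cs : List Rank3PSatCertC}, rank3PSatCheckCAll p rows cs = true →
      ∀ r ∈ rows, ∀ h : r.check = true, ∀ a : r.curve.toAffine.Point,
        p • a ∈ AddSubgroup.closure {r.gen₁ h, r.gen₂ h, r.gen₃ h} ⊔ AddCommGroup.torsion _ →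
          a ∈ AddSubgroup.closure {r.gen₁ h, r.gen₂ h, r.gen₃ h} ⊔ AddCommGroup.torsion _
  | [], _, _ => by simp
  | _ :: _, [], hc => by simp [rank3PSatCheckCAll] at hc
  | r :: rs, c :: cs, hc => by
    rw [rank3PSatCheckCAll, Bool.and_eq_true] at hc
    intro r' hr'
    rcases List.mem_cons.mp hr' with rfl | hmem
    · exact fun h => r'.pSaturated_of_pSatCheckC h p c hc.1
    · exact Rank3Row.pSaturated_of_pSatCheckCAll p hc.2 r' hmem

end Summit.BirchSwinnertonDyer.BirchSwinnertonDyer.Rank2Observatory
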